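import Summits.QuantumFields.YangMills.Theses.SmallCircleAnchor
import HarnessLib

/-!
# `PolyakovAnchorClustering` (stmt-QuantumFields-11144) is the Polyakov-loop special case of the crux `AnchorGap` (stmt-QuantumFields-11141)

Support file for the statement item stmt-QuantumFields-11144 of route `SmallCircleAnchor`
(sub-problem `YangMills`).  The route thesis files `PolyakovAnchorClustering` as "SPECIAL CASE of
AnchorGap for the Polyakov-loop two-point function"; this file makes the specialisation
machine-checked:

`Summit.QuantumFields.YangMills.Theses.SmallCircleAnchor.AnchorGap →
 Summit.QuantumFields.YangMills.Theses.SmallCircleAnchor.PolyakovAnchorClustering`.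

Proof.  Both items share the setting (`G`, faithful `r`, abelianising `V`, temporal extent `T`,
schedule `E`, threshold `β₀`, rate `m`) and the inlined finite-temperature vocabulary
(`St, Cfg, ν, sh, pl, act, P, wgt, Ex`).  `AnchorGap` bounds, for every cube side `w`, the
connected correlation `|Ex (F₁ · F₂∘σₙ) − Ex F₁ · Ex (F₂∘σₙ)| ≤ C(w) e^{−m n}` of measurable local
observables bounded by `1`.  Take `w = 0`, base point `c = 0` and the four observables
`Re χ(P₀)/N`, `Im χ(P₀)/N` (`N = r.N`, `χ = tr ∘ r.ρ`, `P₀` the Polyakov line above the spatial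
origin: they depend only on the `T` time-like links based at spatial coordinate `0`, are continuous
hence measurable — `G` is second countable through the closed embedding `r.ρ` — and are bounded by
`1` because `|tr U| ≤ N` for unitary `U`); the shifted observable `F₂∘σₙ` is `Re χ(P_{n e₀})/N`
(resp. `Im`).  Since `Re (χ₀ · conj χ_y) = Re χ₀ · Re χ_y + Im χ₀ · Im χ_y` and `Ex` is additive on
continuous integrands (continuous functions on the compact configuration space are integrable for
the finite product Haar measure), the connected Polyakov correlator of the item is
`N² · (Cov(Re,Re) + Cov(Im,Im))`, bounded by `2 N² C(0) e^{−m n}`.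

What is NOT here: no proof of `AnchorGap` (an open problem: Polyakov's 1977 monopole mechanism made
rigorous); the item stmt-QuantumFields-11144 therefore stays open and is dominated by
stmt-QuantumFields-11141.
-/

namespace Summit.QuantumFields.YangMills.Theorems.PolyakovAnchorClustering

open MeasureTheory
open Summit.QuantumFields.YangMills.Theses

/-- For a unitary `N × N` matrix `M`, `|Re tr M / N| ≤ 1` (each entry has modulus `≤ 1`; for
`N = 0` both sides are read with `x / 0 = 0`). [folklore] -/
theorem abs_trace_re_div_le_one {N : ℕ} {M : Matrix (Fin N) (Fin N) ℂ}
    (hM : M ∈ Matrix.unitaryGroup (Fin N) ℂ) : |M.trace.re / (N : ℝ)| ≤ 1 := by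
  rcases Nat.eq_zero_or_pos N with hN | hN
  · subst hN; simp
  have hN' : (0 : ℝ) < N := by exact_mod_cast hN
  rw [abs_div, abs_of_pos hN', div_le_one hN']
  calc |M.trace.re| ≤ ‖M.trace‖ := Complex.abs_re_le_norm _
    _ ≤ ∑ i, ‖M.diag i‖ := norm_sum_le _ _
    _ ≤ ∑ _i : Fin N, (1 : ℝ) := Finset.sum_le_sum fun i _ => entry_norm_bound_of_unitary hM i i
    _ = N := by simp

/-- For a unitary `N × N` matrix `M`, `|Im tr M / N| ≤ 1`. [folklore] -/
theorem abs_trace_im_div_le_one {N : ℕ} {M : Matrix (Fin N) (Fin N) ℂ}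
    (hM : M ∈ Matrix.unitaryGroup (Fin N) ℂ) : |M.trace.im / (N : ℝ)| ≤ 1 := by
  rcases Nat.eq_zero_or_pos N with hN | hN
  · subst hN; simp
  have hN' : (0 : ℝ) < N := by exact_mod_cast hN
  rw [abs_div, abs_of_pos hN', div_le_one hN']
  calc |M.trace.im| ≤ ‖M.trace‖ := Complex.abs_im_le_norm _
    _ ≤ ∑ i, ‖M.diag i‖ := norm_sum_le _ _
    _ ≤ ∑ _i : Fin N, (1 : ℝ) := Finset.sum_le_sum fun i _ => entry_norm_bound_of_unitary hM i i
    _ = N := by simp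

/-- The trace of a `0 × 0` matrix vanishes. [folklore] -/
theorem trace_eq_zero_of_eq_zero {N : ℕ} (hN : N = 0) (M : Matrix (Fin N) (Fin N) ℂ) :
    M.trace = 0 := by
  subst hN; simp [Matrix.trace]

/-- **Abstract assembly of the connected Polyakov correlator.**  With `Ex F = (∫ F w dν)/(∫ w dν)`:
if the rescaled covariances `Cov(Re a/N, Re b/N)` and `Cov(Im a/N, Im b/N)` are both `≤ C e`, and the
two product integrands are integrable, then
`|Ex Re(a · conj b) − (Ex Re a · Ex Re b + Ex Im a · Ex Im b)| ≤ 2 N² C e`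
(for `N = 0` one asks `a = b = 0`). [folklore] -/
theorem connected_re_mul_conj_le {Ω : Type*} [MeasurableSpace Ω] (ν : Measure Ω) (w : Ω → ℝ)
    (a b : Ω → ℂ) (N C e : ℝ)
    (hz : N = 0 → ∀ U, a U = 0 ∧ b U = 0)
    (hre_int : Integrable (fun U => (a U).re * (b U).re * w U) ν)
    (him_int : Integrable (fun U => (a U).im * (b U).im * w U) ν)
    (hre : |(∫ U, (a U).re / N * ((b U).re / N) * w U ∂ν) / (∫ U, w U ∂ν) -
        (∫ U, (a U).re / N * w U ∂ν) / (∫ U, w U ∂ν) *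
          ((∫ U, (b U).re / N * w U ∂ν) / (∫ U, w U ∂ν))| ≤ C * e)
    (him : |(∫ U, (a U).im / N * ((b U).im / N) * w U ∂ν) / (∫ U, w U ∂ν) -
        (∫ U, (a U).im / N * w U ∂ν) / (∫ U, w U ∂ν) *
          ((∫ U, (b U).im / N * w U ∂ν) / (∫ U, w U ∂ν))| ≤ C * e) :
    |(∫ U, (a U * (starRingEnd ℂ) (b U)).re * w U ∂ν) / (∫ U, w U ∂ν) -
        ((∫ U, (a U).re * w U ∂ν) / (∫ U, w U ∂ν) * ((∫ U, (b U).re * w U ∂ν) / (∫ U, w U ∂ν)) +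
          (∫ U, (a U).im * w U ∂ν) / (∫ U, w U ∂ν) *
            ((∫ U, (b U).im * w U ∂ν) / (∫ U, w U ∂ν)))| ≤ 2 * N ^ 2 * C * e := by
  have hCe : 0 ≤ C * e := (abs_nonneg _).trans hre
  -- split the integrand `Re (a · conj b) = Re a · Re b + Im a · Im b`
  have hsplit : (fun U => (a U * (starRingEnd ℂ) (b U)).re * w U) =
      fun U => (a U).re * (b U).re * w U + (a U).im * (b U).im * w U := by
    funext U; rw [Complex.mul_re, Complex.conj_re, Complex.conj_im]; ring
  rw [hsplit, integral_add hre_int him_int, add_div]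
  rcases eq_or_ne N 0 with hN | hN
  · have ha : ∀ U, a U = 0 := fun U => (hz hN U).1
    have hb : ∀ U, b U = 0 := fun U => (hz hN U).2
    simp only [ha, hb, Complex.zero_re, Complex.zero_im, zero_mul, integral_zero, zero_div,
      mul_zero, add_zero, sub_self, abs_zero, hN]
    norm_num
  -- `N ≠ 0`: undo the rescaling by `1/N`
  set Z : ℝ := ∫ U, w U ∂ν
  have key : ∀ (p q : Ω → ℝ), Integrable (fun U => p U * q U * w U) ν →
      |(∫ U, p U / N * (q U / N) * w U ∂ν) / Z -
        (∫ U, p U / N * w U ∂ν) / Z * ((∫ U, q U / N * w U ∂ν) / Z)| ≤ C * e →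
      |(∫ U, p U * q U * w U ∂ν) / Z - (∫ U, p U * w U ∂ν) / Z * ((∫ U, q U * w U ∂ν) / Z)| ≤
        N ^ 2 * (C * e) := by
    intro p q _ h
    have e1 : (fun U => p U / N * (q U / N) * w U) = fun U => (N ^ 2)⁻¹ * (p U * q U * w U) := by
      funext U; field_simp
    have e2 : (fun U => p U / N * w U) = fun U => N⁻¹ * (p U * w U) := by
      funext U; field_simp
    have e3 : (fun U => q U / N * w U) = fun U => N⁻¹ * (q U * w U) := by
      funext U; field_simp
    rw [e1, e2, e3, integral_const_mul, integral_const_mul, integral_const_mul] at h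
    have e4 : (N ^ 2)⁻¹ * (∫ U, p U * q U * w U ∂ν) / Z -
        N⁻¹ * (∫ U, p U * w U ∂ν) / Z * (N⁻¹ * (∫ U, q U * w U ∂ν) / Z) =
        (N ^ 2)⁻¹ * ((∫ U, p U * q U * w U ∂ν) / Z -
          (∫ U, p U * w U ∂ν) / Z * ((∫ U, q U * w U ∂ν) / Z)) := by ring
    rw [e4, abs_mul, abs_inv, abs_pow, sq_abs, ← div_eq_inv_mul,
      div_le_iff₀ (by positivity)] at h
    linarith
  have h1 := key (fun U => (a U).re) (fun U => (b U).re) hre_int hre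
  have h2 := key (fun U => (a U).im) (fun U => (b U).im) him_int him
  calc _ = |((∫ U, (a U).re * (b U).re * w U ∂ν) / Z -
            (∫ U, (a U).re * w U ∂ν) / Z * ((∫ U, (b U).re * w U ∂ν) / Z)) +
          ((∫ U, (a U).im * (b U).im * w U ∂ν) / Z -
            (∫ U, (a U).im * w U ∂ν) / Z * ((∫ U, (b U).im * w U ∂ν) / Z))| := by ring_nf
    _ ≤ _ := abs_add_le _ _
    _ ≤ N ^ 2 * (C * e) + N ^ 2 * (C * e) := add_le_add h1 h2
    _ = 2 * N ^ 2 * C * e := by ring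

/-- **Dominance `11141 ⇒ 11144`.** `AnchorGap` (stmt-QuantumFields-11141) implies
`PolyakovAnchorClustering` (stmt-QuantumFields-11144): the same `V`, `E`, `β₀`, `m`, and the
constant `2 N² C(0)` where `C(0)` is the anchor's clustering constant for cube side `w = 0`,
applied at base point `c = 0` to the observables `Re χ(P₀)/N`, `Im χ(P₀)/N`. [folklore] -/
theorem PolyakovAnchorClustering_of_anchorGap (hA : SmallCircleAnchor.AnchorGap) :
    SmallCircleAnchor.PolyakovAnchorClustering := by
  intro G _ _ _ _ hG
  letI : MeasurableSpace G := borel G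
  haveI : BorelSpace G := ⟨rfl⟩
  intro r
  obtain ⟨V, hV, hanch⟩ := hA G hG r
  refine ⟨V, hV, ?_⟩
  intro T _ ε₁
  obtain ⟨E, hE, β₀, hβ₀⟩ := hanch T ε₁
  refine ⟨E, hE, β₀, fun β hβ => ?_⟩
  obtain ⟨m, hm, hw⟩ := hβ₀ β hβ
  obtain ⟨C, hC⟩ := hw 0
  refine ⟨m, hm, 2 * (r.N : ℝ) ^ 2 * C, ?_⟩
  intro L _ St Cfg ν sh pl act P wgt Ex χ n hn y
  -- `G` is second countable (closed embedding `r.ρ` into matrices), so continuous maps on the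
  -- countable product `Cfg` are measurable for the product σ-algebra.
  haveI : SecondCountableTopology G :=
    (r.continuous.isClosedEmbedding r.injective).isEmbedding.secondCountableTopology
  -- continuity of the building blocks
  have hPcont : ∀ x : Fin 3 → ZMod L, Continuous fun U : Cfg => P U x := by
    intro x
    show Continuous fun U : Cfg =>
      (List.ofFn fun t : Fin T => U ((((t : ℕ) : ZMod T), x), none)).prod
    simp only [List.ofFn_eq_map]
    exact continuous_list_prod _ fun t _ => continuous_apply _
  have hχre : ∀ x, Continuous fun U : Cfg => (χ U x).re := fun x =>
    Complex.continuous_re.comp (r.continuous.comp (hPcont x)).matrix_trace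
  have hχim : ∀ x, Continuous fun U : Cfg => (χ U x).im := fun x =>
    Complex.continuous_im.comp (r.continuous.comp (hPcont x)).matrix_trace
  have hpl : ∀ (x : St) (μ κ : Option (Fin 3)), Continuous fun U : Cfg => pl U x μ κ := by
    intro x μ κ
    show Continuous fun U : Cfg => U (x, μ) * U (sh x μ, κ) * (U (sh x κ, μ))⁻¹ * (U (x, κ))⁻¹
    fun_prop
  have htr : ∀ (x : St) (μ κ : Option (Fin 3)),
      Continuous fun U : Cfg => (r.ρ (pl U x μ κ)).trace.re := fun x μ κ =>
    Complex.continuous_re.comp (r.continuous.comp (hpl x μ κ)).matrix_trace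
  have hact : Continuous act :=
    (continuous_const.mul (continuous_finsetSum _ fun x _ =>
      continuous_finsetSum _ fun i _ => htr x none (some i))).add
    (continuous_const.mul (continuous_finsetSum _ fun x _ =>
      continuous_finsetSum _ fun q _ => htr x (some q.1.1) (some q.1.2)))
  have hwgt : Continuous wgt :=
    Real.continuous_exp.comp (hact.sub (continuous_const.mul
      (continuous_finsetSum _ fun x _ => hV.1.comp (hPcont x))))
  -- the four local observables
  let FR : Cfg → ℝ := fun U => (χ U 0).re / (r.N : ℝ)
  let FI : Cfg → ℝ := fun U => (χ U 0).im / (r.N : ℝ)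
  let FR' : Cfg → ℝ := fun U => (χ U y).re / (r.N : ℝ)
  let FI' : Cfg → ℝ := fun U => (χ U y).im / (r.N : ℝ)
  -- locality at the spatial origin: `P U 0` only reads the links `((t, 0), none)`
  have hP0 : ∀ U U' : Cfg,
      (∀ p : St × Option (Fin 3), (∀ i : Fin 3, (p.1.2 i - (0 : Fin 3 → ZMod L) i).val ≤ 0) →
        U p = U' p) → P U 0 = P U' 0 := by
    intro U U' h
    show (List.ofFn fun t : Fin T => U ((((t : ℕ) : ZMod T), (0 : Fin 3 → ZMod L)), none)).prod =
      (List.ofFn fun t : Fin T => U' ((((t : ℕ) : ZMod T), (0 : Fin 3 → ZMod L)), none)).prod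
    refine congrArg List.prod (congrArg List.ofFn (funext fun t => h _ fun i => ?_))
    simp
  have hFR : Measurable FR ∧ (∀ U, |FR U| ≤ 1) ∧ ∀ U U' : Cfg,
      (∀ p : St × Option (Fin 3), (∀ i : Fin 3, (p.1.2 i - (0 : Fin 3 → ZMod L) i).val ≤ 0) →
        U p = U' p) → FR U = FR U' :=
    ⟨((hχre 0).div_const _).measurable, fun U => abs_trace_re_div_le_one (r.mem_unitary _),
      fun U U' h => by show (r.ρ (P U 0)).trace.re / (r.N : ℝ) = (r.ρ (P U' 0)).trace.re / (r.N : ℝ)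
                       rw [hP0 U U' h]⟩
  have hFI : Measurable FI ∧ (∀ U, |FI U| ≤ 1) ∧ ∀ U U' : Cfg,
      (∀ p : St × Option (Fin 3), (∀ i : Fin 3, (p.1.2 i - (0 : Fin 3 → ZMod L) i).val ≤ 0) →
        U p = U' p) → FI U = FI U' :=
    ⟨((hχim 0).div_const _).measurable, fun U => abs_trace_im_div_le_one (r.mem_unitary _),
      fun U U' h => by show (r.ρ (P U 0)).trace.im / (r.N : ℝ) = (r.ρ (P U' 0)).trace.im / (r.N : ℝ)
                       rw [hP0 U U' h]⟩
  -- the anchor's clustering bound at `w = 0`, `c = 0`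
  have h1 := hC L 0 FR FR hFR hFR n hn
  have h2 := hC L 0 FI FI hFI hFI n hn
  -- the shifted observables are the Polyakov observables at `y = n e₀`
  have eR : (fun U : Cfg => FR (fun p => U ((p.1.1, p.1.2 + Pi.single 0 (n : ZMod L)), p.2))) = FR' := by
    funext U
    simp +zetaDelta only [zero_add]
  have eI : (fun U : Cfg => FI (fun p => U ((p.1.1, p.1.2 + Pi.single 0 (n : ZMod L)), p.2))) = FI' := by
    funext U
    simp +zetaDelta only [zero_add]
  have h1' : |Ex (fun U => FR U * FR' U) - Ex FR * Ex FR'| ≤ C * Real.exp (-(m * n)) := by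
    rw [← eR]; exact h1
  have h2' : |Ex (fun U => FI U * FI' U) - Ex FI * Ex FI'| ≤ C * Real.exp (-(m * n)) := by
    rw [← eI]; exact h2
  -- integrability of the (continuous) product integrands on the compact configuration space
  have hintR : Integrable (fun U : Cfg => (χ U 0).re * (χ U y).re * wgt U) ν :=
    (((hχre 0).mul (hχre y)).mul hwgt).integrable_of_hasCompactSupport
      (HasCompactSupport.of_compactSpace _)
  have hintI : Integrable (fun U : Cfg => (χ U 0).im * (χ U y).im * wgt U) ν :=
    (((hχim 0).mul (hχim y)).mul hwgt).integrable_of_hasCompactSupport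
      (HasCompactSupport.of_compactSpace _)
  have hz : (r.N : ℝ) = 0 → ∀ U : Cfg, χ U 0 = 0 ∧ χ U y = 0 := by
    intro hN U
    have hN' : r.N = 0 := by exact_mod_cast hN
    exact ⟨trace_eq_zero_of_eq_zero hN' _, trace_eq_zero_of_eq_zero hN' _⟩
  exact connected_re_mul_conj_le ν wgt (fun U => χ U 0) (fun U => χ U y) (r.N : ℝ) C
    (Real.exp (-(m * n))) hz hintR hintI h1' h2'

end Summit.QuantumFields.YangMills.Theorems.PolyakovAnchorClustering
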